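import Summits.QuantumFields.YangMills.Theorems.LuscherReductionTwistedTraceScalingRecordWeightRho
import Summits.QuantumFields.YangMills.Theorems.LuscherReductionTwistedTraceScalingVacGradKernel
import HarnessLib

/-!
# A BASED gauge transformation that keeps a near-vacuum configuration near the vacuum is itself near `1` at every site (connectivity from the origin)
# (lane A of S-BASE, crux `TwistedTraceScaling` stmt-QuantumFields-20203, C4 INNER; design note `pub/ym-fleet/ym-luscher-20007-p1/COARSE-DESIGN.md` §23.9 (N2-a))

In the based average `N(U) = ∫ recordWeightRho(U^{basedExt h}) dh` (`…GaugeAverageBased`) the integrand vanishes unless `U^{basedExt h}` is in the fat tube.  THIS FILE: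
if `U ∈ nearOne r₁`, `h 0 = 1` and `U^h ∈ nearOne r₂`, then ★★ `frobNorm_sub_one_le_of_based`: `‖h_x − 1‖_F ≤ 3(L−1)·(r₁ + r₂)` for EVERY site `x` — one step along a link
`e = (x, k)` costs `r₁ + r₂` (`h_{x+k} = (U^h)_e⁻¹ · h_x · U_e`, ★ `frobNorm_shift_sub_one_le`), and every site is reached from the origin in at most `3(L−1)` steps.
So only gauge transformations within `O(L·ρ)` of the identity contribute to `N`: in the gnomonic product chart of the based group only the all-positive hemisphere pattern meets the
support, and there `h = P∘v` with `v` small — the domain of the linearisation `…GaugeActionBased`.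
HONEST FRAMING: elementary bookkeeping for a stub of a child of the CONDITIONAL reduction route R2b1; no spectral claim; C4 OPEN; not a gap, not Clay.
-/

set_option autoImplicit false

noncomputable section

open Real
open scoped BigOperators
open Literature.MathematicalPhysics.QuantumFieldTheory
open Literature.MathematicalPhysics.QuantumLattice

namespace Summit.QuantumFields.YangMills.Theorems.FemtoTransferGap.TwoLattice.ConstTube

open Summit.QuantumFields.YangMills.Theorems.FemtoTransferGap

variable (L : ℕ) [NeZero L]

omit [NeZero L] in
/-- Along a link: `h_{x+k} = (U^h)_{(x,k)}⁻¹ · h_x · U_{(x,k)}`. [folklore] -/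
theorem gauge_shift_eq (h : Site 3 L → SU2) (U : GaugeConfig 3 L SU2) (x : Site 3 L) (k : Fin 3) :
    h (x.shift k) = (gaugeTransform h U (x, k))⁻¹ * h x * U (x, k) := by
  simp only [gaugeTransform]
  group

omit [NeZero L] in
/-- ★ **One step**: `‖h_{x+k} − 1‖_F ≤ ‖h_x − 1‖_F + ‖U_e − 1‖_F + ‖(U^h)_e − 1‖_F`. [folklore] -/
theorem frobNorm_shift_sub_one_le (h : Site 3 L → SU2) (U : GaugeConfig 3 L SU2) (x : Site 3 L) (k : Fin 3) :
    frobNorm (((h (x.shift k) : SU2) : Matrix (Fin 2) (Fin 2) ℂ) - 1) ≤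
      frobNorm (((h x : SU2) : Matrix (Fin 2) (Fin 2) ℂ) - 1) + frobNorm (((U (x, k) : SU2) : Matrix (Fin 2) (Fin 2) ℂ) - 1) +
        frobNorm (((gaugeTransform h U (x, k) : SU2) : Matrix (Fin 2) (Fin 2) ℂ) - 1) := by
  rw [gauge_shift_eq L h U x k]
  have h1 := frobNorm_mul_sub_one_le ((gaugeTransform h U (x, k))⁻¹ * h x) (U (x, k))
  have h2 := frobNorm_mul_sub_one_le ((gaugeTransform h U (x, k))⁻¹) (h x)
  rw [frobNorm_inv_sub_one] at h2
  linarith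

omit [NeZero L] in
/-- Iterated steps in one direction: `‖h_{x + n e_k} − 1‖_F ≤ ‖h_x − 1‖_F + n·(r₁ + r₂)`. [folklore] -/
theorem frobNorm_iterate_sub_one_le {h : Site 3 L → SU2} {U : GaugeConfig 3 L SU2} {r₁ r₂ : ℝ} (hU : U ∈ nearOne L r₁) (hUh : gaugeTransform h U ∈ nearOne L r₂)
    (x : Site 3 L) (k : Fin 3) (n : ℕ) :
    frobNorm (((h (x + Pi.single k (n : ZMod L)) : SU2) : Matrix (Fin 2) (Fin 2) ℂ) - 1) ≤ frobNorm (((h x : SU2) : Matrix (Fin 2) (Fin 2) ℂ) - 1) + n * (r₁ + r₂) := by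
  induction n with
  | zero => simp
  | succ n ih =>
    have hstep : x + Pi.single k ((n + 1 : ℕ) : ZMod L) = (x + Pi.single k (n : ZMod L)).shift k := by
      simp only [Site.shift, Nat.cast_succ, add_assoc, ← Pi.single_add]
    rw [hstep]
    have h1 := frobNorm_shift_sub_one_le L h U (x + Pi.single k (n : ZMod L)) k
    have h2 := hU (x + Pi.single k (n : ZMod L), k)
    have h3 := hUh (x + Pi.single k (n : ZMod L), k)
    push_cast
    linarith

/-- ★★ **A BASED GAUGE TRANSFORMATION PRESERVING NEARNESS TO THE VACUUM IS NEAR `1` EVERYWHERE**: `U ∈ nearOne r₁`, `h 0 = 1`, `U^h ∈ nearOne r₂` ⇒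
`‖h_x − 1‖_F ≤ 3(L−1)(r₁ + r₂)` for every site `x`. [folklore] -/
theorem frobNorm_sub_one_le_of_based {h : Site 3 L → SU2} {U : GaugeConfig 3 L SU2} {r₁ r₂ : ℝ} (hU : U ∈ nearOne L r₁) (hUh : gaugeTransform h U ∈ nearOne L r₂)
    (h0 : h 0 = 1) (x : Site 3 L) :
    frobNorm (((h x : SU2) : Matrix (Fin 2) (Fin 2) ℂ) - 1) ≤ 3 * ((L : ℝ) - 1) * (r₁ + r₂) := by
  have hr : 0 ≤ r₁ + r₂ := by
    have h1 := hU ((0 : Site 3 L), 0); have h2 := hUh ((0 : Site 3 L), 0)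
    linarith [frobNorm_nonneg (((U (0, 0) : SU2) : Matrix (Fin 2) (Fin 2) ℂ) - 1), frobNorm_nonneg (((gaugeTransform h U (0, 0) : SU2) : Matrix (Fin 2) (Fin 2) ℂ) - 1)]
  have hx : x = ((0 : Site 3 L) + Pi.single 0 ((ZMod.val (x 0) : ℕ) : ZMod L)) + Pi.single 1 ((ZMod.val (x 1) : ℕ) : ZMod L) +
      Pi.single 2 ((ZMod.val (x 2) : ℕ) : ZMod L) := by
    funext i
    simp only [Pi.add_apply, Pi.zero_apply, ZMod.natCast_val, ZMod.cast_id', id_eq]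
    fin_cases i <;> simp
  have hval : ∀ i : Fin 3, ((ZMod.val (x i) : ℕ) : ℝ) ≤ (L : ℝ) - 1 := fun i => by
    have hlt := ZMod.val_lt (x i)
    have hL : (1 : ℕ) ≤ L := NeZero.one_le
    have h' : ZMod.val (x i) ≤ L - 1 := by omega
    calc ((ZMod.val (x i) : ℕ) : ℝ) ≤ ((L - 1 : ℕ) : ℝ) := by exact_mod_cast h'
      _ = (L : ℝ) - 1 := by rw [Nat.cast_sub hL, Nat.cast_one]
  have e1 := frobNorm_iterate_sub_one_le L hU hUh 0 0 (ZMod.val (x 0))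
  have e2 := frobNorm_iterate_sub_one_le L hU hUh ((0 : Site 3 L) + Pi.single 0 ((ZMod.val (x 0) : ℕ) : ZMod L)) 1 (ZMod.val (x 1))
  have e3 := frobNorm_iterate_sub_one_le L hU hUh (((0 : Site 3 L) + Pi.single 0 ((ZMod.val (x 0) : ℕ) : ZMod L)) + Pi.single 1 ((ZMod.val (x 1) : ℕ) : ZMod L)) 2
    (ZMod.val (x 2))
  rw [h0, OneMemClass.coe_one, sub_self, frobNorm_zero] at e1
  rw [hx]
  have hb0 := mul_le_mul_of_nonneg_right (hval 0) hr
  have hb1 := mul_le_mul_of_nonneg_right (hval 1) hr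
  have hb2 := mul_le_mul_of_nonneg_right (hval 2) hr
  linarith

/-- Consequence for based gauge transformations of `…GaugeAverageBased`: `basedExt h` is near `1` everywhere when `U, U^{basedExt h}` are near the vacuum. [folklore] -/
theorem frobNorm_basedExt_sub_one_le {hb : NzSite L → SU2} {U : GaugeConfig 3 L SU2} {r₁ r₂ : ℝ} (hU : U ∈ nearOne L r₁)
    (hUh : gaugeTransform (basedExt L hb) U ∈ nearOne L r₂) (x : Site 3 L) :
    frobNorm (((basedExt L hb x : SU2) : Matrix (Fin 2) (Fin 2) ℂ) - 1) ≤ 3 * ((L : ℝ) - 1) * (r₁ + r₂) :=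
  frobNorm_sub_one_le_of_based L hU hUh (basedExt_zero L hb) x

end Summit.QuantumFields.YangMills.Theorems.FemtoTransferGap.TwoLattice.ConstTube

end
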